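import Literature.NumberTheory.GaloisRepresentations.RamificationFiltrationHerbrandInverseProofs
import HarnessLib

/-!
# The Herbrand function `φ`: explicit values and consequences for the upper numbering (trunk GalRep, item C9)

For a finite group `G` acting on a commutative ring `S` and an ideal `𝔓`, the parent file
`RamificationFiltration.lean` defines `φ = herbrandPhi 𝔓 G`, `ψ = herbrandPsi 𝔓 G` and the upper
numbering `G^v = G_{⌈ψ v⌉₊}`; the sibling proofs files
(`RamificationFiltrationHerbrandProofs`, `…PsiProofs`, `…InverseProofs`) prove that `φ` is a
strictly increasing continuous bijection of `ℝ` with inverse `ψ`.  This file adds what Herbrand's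
theorem (`HerbrandTheorem.lean`) needs beyond that:

* order lemmas: `herbrandPhi_mono`, `herbrandPhi_injective`, `herbrandPhi_nonneg_iff`,
  `herbrandPsi_le_iff`, `le_herbrandPsi_iff`;
* `φ` is affine on each `[n, n+1]` (`n : ℕ`) with slope `#G_{n+1}/#G_0`, and more generally
  `φ b - φ a = (b - a) κ` whenever the integrand is the constant `κ` on `(a, b]`
  (`herbrandPhi_sub_eq_mul_of_eqOn`, `herbrandPhi_eq_of_mem_Icc`);
* Serre's formula `g₀ (φ(m) + 1) = Σ_{i=0}^{m} g_i` at integers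
  (`card_mul_herbrandPhi_natCast_add_one`);
* the discharges `upperRamificationSubgroup_herbrandPhi_holds` (`G^{φ u} = G_{⌈u⌉₊}`),
  `upperRamificationSubgroup_antitone_holds`, `absUpperRamificationSubgroup_antitone_holds`,
  `absUpperInertia_antitone_holds` of the corresponding named facts of the parent file.

## References

* J.-P. Serre, *Local Fields*, GTM 67, Springer 1979, Ch. IV §3, pp. 73–74: the formulas
  `φ(u) = (g₁ + ⋯ + g_m + (u - m) g_{m+1})/g₀` for `m ≤ u ≤ m + 1` and
  `φ(m) + 1 = (1/g₀) Σ_{i=0}^{m} g_i`; Prop. 12, Prop. 13; `G^{φ(u)} = G_u` (p. 74).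
  [SerreLocalFields1979]
-/

noncomputable section

open MeasureTheory Set Filter

namespace Literature.NumberTheory.GaloisRepresentations

variable {S : Type*} [CommRing S] (𝔓 : Ideal S) (G : Type*) [Group G] [MulSemiringAction G S]

/-! ### Order lemmas for `φ` and `ψ` -/

section Order

/-- `φ` is monotone (finite `G`).  Ref: Serre, *Local Fields*, Ch. IV §3, Prop. 12 a). [folklore] -/
theorem herbrandPhi_mono [Finite G] : Monotone (herbrandPhi 𝔓 G) :=
  (herbrandPhi_strictMono 𝔓 G).monotone

/-- `φ` is injective (finite `G`).  Ref: Serre, *Local Fields*, Ch. IV §3, Prop. 12. [folklore] -/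
theorem herbrandPhi_injective [Finite G] : Function.Injective (herbrandPhi 𝔓 G) :=
  (herbrandPhi_strictMono 𝔓 G).injective

/-- `0 ≤ φ u ↔ 0 ≤ u` (finite `G`).  Ref: Serre, *Local Fields*, Ch. IV §3, Prop. 12 b). [folklore] -/
theorem herbrandPhi_nonneg_iff [Finite G] {u : ℝ} : 0 ≤ herbrandPhi 𝔓 G u ↔ 0 ≤ u := by
  conv_lhs => rw [← herbrandPhi_zero 𝔓 G]
  exact (herbrandPhi_strictMono 𝔓 G).le_iff_le

/-- `ψ v ≤ u ↔ v ≤ φ u` (finite `G`).  Ref: Serre, *Local Fields*, Ch. IV §3 (`ψ = φ⁻¹`). [folklore] -/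
theorem herbrandPsi_le_iff [Finite G] {u v : ℝ} : herbrandPsi 𝔓 G v ≤ u ↔ v ≤ herbrandPhi 𝔓 G u := by
  rw [← (herbrandPhi_strictMono 𝔓 G).le_iff_le, herbrandPhi_herbrandPsi_holds 𝔓 G v]

/-- `u ≤ ψ v ↔ φ u ≤ v` (finite `G`).  Ref: Serre, *Local Fields*, Ch. IV §3 (`ψ = φ⁻¹`). [folklore] -/
theorem le_herbrandPsi_iff [Finite G] {u v : ℝ} : u ≤ herbrandPsi 𝔓 G v ↔ herbrandPhi 𝔓 G u ≤ v := by
  rw [← (herbrandPhi_strictMono 𝔓 G).le_iff_le, herbrandPhi_herbrandPsi_holds 𝔓 G v]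

end Order

/-! ### Explicit values: `φ` is affine on `[n, n+1]` and Serre's formula at integers -/

section Explicit

/-- On `(n, n+1]` (`n : ℕ`) the Herbrand integrand is the constant `#G_{n+1}/#G_0`.
Ref: Serre, *Local Fields*, Ch. IV §3, Prop. 12 c) (slope `1/(G₀ : G_{m+1})` on `]m, m+1[`). [folklore] -/
theorem herbrandIntegrand_eq_of_mem_Ioc {n : ℕ} {t : ℝ} (ht : t ∈ Ioc (n : ℝ) (n + 1)) :
    herbrandIntegrand 𝔓 G t =
      (Nat.card (𝔓.ramificationSubgroup G (n + 1)) : ℝ) / Nat.card (𝔓.ramificationSubgroup G 0) := by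
  have hceil : ⌈t⌉₊ = n + 1 := by
    rw [Nat.ceil_eq_iff (Nat.succ_ne_zero n), Nat.succ_sub_one]
    push_cast
    exact ht
  rw [herbrandIntegrand, inv_div, hceil]

/-- If the integrand is the constant `κ` on `(a, b]`, then `φ b - φ a = (b - a) κ` (finite `G`).
Ref: Serre, *Local Fields*, Ch. IV §3, Prop. 12 (piecewise linearity). [folklore] -/
theorem herbrandPhi_sub_eq_mul_of_eqOn [Finite G] {a b κ : ℝ} (hab : a ≤ b)
    (h : EqOn (herbrandIntegrand 𝔓 G) (fun _ => κ) (Ioc a b)) :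
    herbrandPhi 𝔓 G b - herbrandPhi 𝔓 G a = (b - a) * κ := by
  rw [herbrandPhi_sub_herbrandPhi, intervalIntegral.integral_of_le hab,
    setIntegral_congr_fun measurableSet_Ioc h, setIntegral_const, smul_eq_mul,
    Real.volume_real_Ioc_of_le hab]

/-- `φ` is affine with slope `#G_{n+1}/#G_0` on `[n, n+1]`: for `n ≤ a ≤ b ≤ n + 1`,
`φ b - φ a = (b - a) #G_{n+1}/#G_0`.
Ref: Serre, *Local Fields*, Ch. IV §3, p. 73 (`φ(u) = (g₁ + ⋯ + g_m + (u - m) g_{m+1})/g₀`). [folklore] -/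
theorem herbrandPhi_sub_eq_of_Icc [Finite G] (n : ℕ) {a b : ℝ} (ha : (n : ℝ) ≤ a) (hab : a ≤ b)
    (hb : b ≤ n + 1) :
    herbrandPhi 𝔓 G b - herbrandPhi 𝔓 G a =
      (b - a) * ((Nat.card (𝔓.ramificationSubgroup G (n + 1)) : ℝ) /
        Nat.card (𝔓.ramificationSubgroup G 0)) :=
  herbrandPhi_sub_eq_mul_of_eqOn 𝔓 G hab fun _ ht =>
    herbrandIntegrand_eq_of_mem_Ioc 𝔓 G ⟨lt_of_le_of_lt ha ht.1, ht.2.trans hb⟩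

/-- `φ u = φ n + (u - n) #G_{n+1}/#G_0` for `n ≤ u ≤ n + 1` (`n : ℕ`).
Ref: Serre, *Local Fields*, Ch. IV §3, p. 73. [folklore] -/
theorem herbrandPhi_eq_of_mem_Icc [Finite G] (n : ℕ) {u : ℝ} (hu : u ∈ Icc (n : ℝ) (n + 1)) :
    herbrandPhi 𝔓 G u = herbrandPhi 𝔓 G n +
      (u - n) * ((Nat.card (𝔓.ramificationSubgroup G (n + 1)) : ℝ) /
        Nat.card (𝔓.ramificationSubgroup G 0)) := by
  have h := herbrandPhi_sub_eq_of_Icc 𝔓 G n le_rfl hu.1 hu.2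
  linarith

/-- `φ (n + 1) = φ n + #G_{n+1}/#G_0` (`n : ℕ`).  Ref: Serre, *Local Fields*, Ch. IV §3, p. 73. [folklore] -/
theorem herbrandPhi_natCast_add_one [Finite G] (n : ℕ) :
    herbrandPhi 𝔓 G (n + 1) = herbrandPhi 𝔓 G n +
      (Nat.card (𝔓.ramificationSubgroup G (n + 1)) : ℝ) / Nat.card (𝔓.ramificationSubgroup G 0) := by
  have h := herbrandPhi_eq_of_mem_Icc 𝔓 G n (u := n + 1) ⟨by linarith, le_rfl⟩
  rw [h, add_sub_cancel_left, one_mul]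

/-- Serre's formula `g₀ (φ(m) + 1) = Σ_{i=0}^{m} g_i` (`m : ℕ`, `g_i = #G_i`).
Ref: Serre, *Local Fields*, Ch. IV §3, p. 73 ("In particular, `φ(m) + 1 = (1/g₀) Σ_{i=0}^{m} g_i`"). [cite: SerreLocalFields1979, Ch. IV §3 (p. 73)] -/
theorem card_mul_herbrandPhi_natCast_add_one [Finite G] (m : ℕ) :
    (Nat.card (𝔓.ramificationSubgroup G 0) : ℝ) * (herbrandPhi 𝔓 G m + 1) =
      ∑ i ∈ Finset.range (m + 1), (Nat.card (𝔓.ramificationSubgroup G i) : ℝ) := by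
  have h0 : (Nat.card (𝔓.ramificationSubgroup G 0) : ℝ) ≠ 0 := (Nat.cast_pos.mpr Nat.card_pos).ne'
  induction m with
  | zero => simp
  | succ m ih =>
    rw [Nat.cast_succ, herbrandPhi_natCast_add_one, Finset.sum_range_succ, ← ih]
    field_simp
    ring

end Explicit

/-! ### Consequences for the upper numbering (finite level) -/

section Upper

/-- **Discharge of `Literature.NumberTheory.GaloisRepresentations.upperRamificationSubgroup_herbrandPhi`.**  `G^{φ u} = G_{⌈u⌉₊}` for finite
`G` (`ψ (φ u) = u`).  Ref: Serre, *Local Fields*, Ch. IV §3, p. 74 (`G^{φ(u)} = G_u`). [cite: SerreLocalFields1979, Ch. IV §3 (p. 74)] -/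
theorem upperRamificationSubgroup_herbrandPhi_holds : upperRamificationSubgroup_herbrandPhi 𝔓 G := by
  intro _ u
  rw [upperRamificationSubgroup, herbrandPsi_herbrandPhi_holds 𝔓 G u]

/-- **Discharge of `Literature.NumberTheory.GaloisRepresentations.upperRamificationSubgroup_antitone`.**  The upper numbering is decreasing in
`v` for finite `G` (`ψ` is monotone and the lower filtration is decreasing).
Ref: Serre, *Local Fields*, Ch. IV §3, p. 74. [cite: SerreLocalFields1979, Ch. IV §3 (p. 74)] -/
theorem upperRamificationSubgroup_antitone_holds : upperRamificationSubgroup_antitone 𝔓 G := by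
  intro _ v w hvw
  exact 𝔓.ramificationSubgroup_antitone G (Nat.ceil_le_ceil (herbrandPsi_monotone_holds 𝔓 G hvw))

end Upper

section Absolute

open Field

variable (R : Type*) {K : Type*} [CommRing R] [Field K] [Algebra R K]

/-- **Discharge of `Literature.NumberTheory.GaloisRepresentations.absUpperRamificationSubgroup_antitone`.**  The absolute upper-numbering
filtration `Γ_K^v` is decreasing in `v` (each finite layer is, `upperRamificationSubgroup_antitone_holds`).
Ref: Serre, *Local Fields*, Ch. IV §3, Remark 1 and Prop. 14. [cite: SerreLocalFields1979, Ch. IV §3 Remark 1] -/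
theorem absUpperRamificationSubgroup_antitone_holds :
    absUpperRamificationSubgroup_antitone R (K := K) := by
  intro 𝔓 v w hvw
  refine iInf_mono fun E => iInf_mono fun hfd => iInf_mono fun hn => Subgroup.comap_mono ?_
  haveI := hfd
  exact upperRamificationSubgroup_antitone_holds _ _ hvw

end Absolute

section Local

open Field ValuativeRel GaloisRepresentations.IsNonarchimedeanLocalField
open scoped Valued

variable (F : Type*) [Field F] [ValuativeRel F] [TopologicalSpace F] [IsNonarchimedeanLocalField F]

/-- **Discharge of `Literature.NumberTheory.GaloisRepresentations.absUpperInertia_antitone`.**  `I_F^v` is decreasing in `v`.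
Ref: Serre, *Local Fields*, Ch. IV §3, Remark 1. [cite: SerreLocalFields1979, Ch. IV §3 Remark 1] -/
theorem absUpperInertia_antitone_holds : absUpperInertia_antitone F :=
  absUpperRamificationSubgroup_antitone_holds 𝒪[F] (absMaximalIdeal F)

end Local

end Literature.NumberTheory.GaloisRepresentations
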